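import Literature.NumberTheory.Automorphic.BrandtXi
import HarnessLib

/-!
# Route `RamifiedHeegnerPair`, crux U₁ `LeafRankOneUpperAtThree` (stmt-BirchSwinnertonDyer-26022), line `partnerdescent` —
# partner kernel, base change (α) part 10: the eigenvalues `λ_X` of commuting Hecke generators on a rank-one eigen-line come for free

HONEST FRAMING. Theorems only; helper file (`--supports stmt-BirchSwinnertonDyer-26022 --as helper`); elementary linear algebra over the tree's
`Brandt.eigenLattice` (‹BrandtXi›); no number theory, no named fact, no `sorry`; nothing booked; BSD is proved for no curve. Lead prover
bsd-line-rhp-p2 g64, 2026-08-31.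

WHY. The new stub COORD-INPUTS (`Partnerdescent.LeafBrandtCoordinateInputsAtThree`, skeleton v9; consumed by p814294
`cokernelFifth_of_leafBrandtInputs`) asks, among the (C0) data, for an eigenvalue function `λ` with `X v = λ_X v` for every generator `X ∈ G`
and every `v` in the `a(W′)`-eigen-lattice. This conjunct is NOT an input: it follows from the other (C0) conjuncts (the generators commute
pairwise and contain the Brandt matrices `T_q` at the good primes) and from (D⁺)'s multiplicity one (the eigen-lattice is a line `ℤ g`).
Indeed a matrix commuting with the good `T_q` maps the eigen-lattice into itself, hence acts on the line `ℤ g` by an integer. So the typist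
files (C0) WITHOUT `λ`, and instantiates the stub's `λ` with `exists_eigenvalues_of_forall_commute` below; (C3′) is then stated for THE
eigenvalues (unique since `g ≠ 0`, `eigenvalue_unique`).
[cite: PollackWeston2011, §2.1] [cite: DarmonDiamondTaylor1995, §4.1 (Hecke algebras acting on a rank-one eigenspace)]
-/

set_option linter.dupNamespace false
set_option autoImplicit false

namespace Summit.BirchSwinnertonDyer.BirchSwinnertonDyer.Theorems.LeafPartnerOrders

open Matrix Literature.NumberTheory.Automorphic.Brandt

variable {ι : Type*} [Fintype ι]

/-- **A matrix commuting with the good Hecke matrices preserves the eigen-lattice.** [folklore] -/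
theorem mulVec_mem_eigenLattice_of_forall_commute {N : ℕ} {T : ℕ → Matrix ι ι ℤ} {lam : ℕ → ℤ} {X : Matrix ι ι ℤ}
    (hX : ∀ q : ℕ, q.Prime → ¬ q ∣ N → X * T q = T q * X) {v : ι → ℤ} (hv : v ∈ eigenLattice N T lam) :
    X *ᵥ v ∈ eigenLattice N T lam := by
  intro q hq hqN
  rw [mulVec_mulVec, ← hX q hq hqN, ← mulVec_mulVec, hv q hq hqN, mulVec_smul]

/-- **On a rank-one eigen-line a commuting matrix acts by an integer.** If the eigen-lattice is the line `ℤ g` and `X` commutes with the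
good Hecke matrices, there is `c ∈ ℤ` with `X v = c·v` for every `v` in the eigen-lattice. [cite: PollackWeston2011, §2.1] -/
theorem exists_eigenvalue_of_forall_commute {N : ℕ} {T : ℕ → Matrix ι ι ℤ} {lam : ℕ → ℤ} {X : Matrix ι ι ℤ}
    (hX : ∀ q : ℕ, q.Prime → ¬ q ∣ N → X * T q = T q * X) {g : ι → ℤ} (hL : eigenLattice N T lam = ℤ ∙ g) :
    ∃ c : ℤ, ∀ v ∈ eigenLattice N T lam, X *ᵥ v = c • v := by
  have hgL : g ∈ eigenLattice N T lam := by rw [hL]; exact Submodule.mem_span_singleton_self g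
  have hXg : X *ᵥ g ∈ eigenLattice N T lam := mulVec_mem_eigenLattice_of_forall_commute hX hgL
  rw [hL] at hXg
  obtain ⟨c, hc⟩ := Submodule.mem_span_singleton.mp hXg
  refine ⟨c, fun v hv ↦ ?_⟩
  rw [hL] at hv
  obtain ⟨a, rfl⟩ := Submodule.mem_span_singleton.mp hv
  rw [mulVec_smul, ← hc, smul_comm]

omit [Fintype ι] in
/-- **The eigenvalue is unique** (`g ≠ 0`). [folklore] -/
theorem eigenvalue_unique {g : ι → ℤ} (hg : g ≠ 0) {c c' : ℤ} (h : c • g = c' • g) : c = c' := by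
  obtain ⟨k, hk⟩ := Function.ne_iff.mp hg
  have := congrFun h k
  simp only [Pi.smul_apply, smul_eq_mul] at this
  exact mul_right_cancel₀ hk this

/-- **The eigenvalue function of a commuting family on a rank-one eigen-line.** For a set `G` of integer matrices each commuting with the
good Hecke matrices `T_q` (`q ∤ N` prime) — e.g. pairwise commuting and containing them — and an eigen-lattice that is a line, there is
`λ : Matrix → ℤ` with `X v = λ_X·v` for all `X ∈ G`, `v` in the eigen-lattice: the `λ` of the stub `LeafBrandtCoordinateInputsAtThree`.
[cite: PollackWeston2011, §2.1] -/
theorem exists_eigenvalues_of_forall_commute {N : ℕ} {T : ℕ → Matrix ι ι ℤ} {lam : ℕ → ℤ} (G : Set (Matrix ι ι ℤ))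
    (hG : ∀ X ∈ G, ∀ q : ℕ, q.Prime → ¬ q ∣ N → X * T q = T q * X) {g : ι → ℤ} (hL : eigenLattice N T lam = ℤ ∙ g) :
    ∃ lamG : Matrix ι ι ℤ → ℤ, ∀ X ∈ G, ∀ v ∈ eigenLattice N T lam, X *ᵥ v = lamG X • v := by
  classical
  have h : ∀ X : Matrix ι ι ℤ, ∃ c : ℤ, X ∈ G → ∀ v ∈ eigenLattice N T lam, X *ᵥ v = c • v := by
    intro X
    by_cases hX : X ∈ G
    · obtain ⟨c, hc⟩ := exists_eigenvalue_of_forall_commute (hG X hX) hL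
      exact ⟨c, fun _ ↦ hc⟩
    · exact ⟨0, fun h ↦ absurd h hX⟩
  choose lamG hlamG using h
  exact ⟨lamG, fun X hX ↦ hlamG X hX⟩

/-- **Pairwise commuting generators containing the good `T_q` commute with the good `T_q`** — the form in which (C0) is filed.
[folklore] -/
theorem forall_commute_of_pairwise {N : ℕ} {T : ℕ → Matrix ι ι ℤ} (G : Set (Matrix ι ι ℤ))
    (hGcomm : ∀ X ∈ G, ∀ X' ∈ G, X * X' = X' * X) (hGan : ∀ q : ℕ, q.Prime → ¬ q ∣ N → T q ∈ G) :
    ∀ X ∈ G, ∀ q : ℕ, q.Prime → ¬ q ∣ N → X * T q = T q * X :=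
  fun X hX q hq hqN ↦ hGcomm X hX (T q) (hGan q hq hqN)

end Summit.BirchSwinnertonDyer.BirchSwinnertonDyer.Theorems.LeafPartnerOrders
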